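import Summits.QuantumFields.YangMills.Theorems.AlphaInputsT3ACv3LinearAvgSup
import Summits.QuantumFields.YangMills.Theorems.AlphaInputsT3ACv3EMLSecondOrderMain
import HarnessLib

/-!
# `AlphaInputsT3ACv3LinearAvgMatrix` — STRATEGY B for 2′, non-abelian (FL) bookkeeping: **THE MATRIX-VALUED ITERATED (0.4)-LINEAR AVERAGES** `Q s Y` (any family with `Q 0 = id`,
# `Q (s+1) Y c = linAvg (Q s Y) c` — the composites of the tree's `BlockAveragingEMLLinearised.linAvg`, characterised as in `Prop7AvgLinearisation`), their NATURALITY (`φ (Q s Y c) = linAvgIter s (φ ∘ Y) c`: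
# the two (0.4)-linear vocabularies of the tree — `walkSum`∕`linAvg` on matrices, `wsum`∕`linAvg04`∕`linAvgIter` on reals — agree), and the `s`-UNIFORM SUP BOUND
# `‖Q s Y (c)‖ ≤ 2|n|²·(d+1)·L^s·δ` from `…v3LinearAvgSup.abs_linAvgIter_le` read entry by entry — lane `pub-balaban3d` ∕ cell `ym3-torus`, seat `ym-ust-19936-w1` (g0)

WHY (HOME `ym-ust-19936-w1/NONABELIAN-FL-ARCH-w1-g0.md` §8).  The `k`-fold linearisation of the (0.4)∕EML average at the flat background ([Balaban1985Averaging] Prop. 4 (134)–(135), here for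
`su(N)`-valued fine fields on the torus) iterates the one-step expansion `log Ū(c) = (Q₁Y)(c) + O((ℓδ)²)` of `…v3EMLSecondOrder(Main)`; its main term after `s` steps is the composite `Q₁^s Y`
and the smallness hypotheses of each further step need `sup‖Q₁^s Y‖` to grow like `L^s` with an `s`-INDEPENDENT constant — the content of `…v3LinearAvgSup` for real one-forms, transported here
(the tree's flat `k`-fold statement `Prop7AvgLinearisation.norm_iter_sub_one_sub_iterLin_le` carries `(4ℓ)^k` instead).
WHAT IS HERE.  §1 matrix-norm utilities (`abs_re_im_entry_le_norm`: `|Re∕Im A_{ij}| ≤ ‖A‖`; `norm_le_sum_abs_re_add_abs_im`: `‖A‖ ≤ Σ_{i,j}(|Re A_{ij}| + |Im A_{ij}|)`, `L²`-operator norm);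
§2 `map_walkSum` (additive maps pass through signed walk sums), `walkSum_walk_eq_wsum` (on reals the step-list sum along `walk x w` IS `AbelianEML.wsum`), ★ `apply_linAvg`
(`φ(linAvg Y c) = linAvg04 (φ∘Y) c` for `φ : Matrix →ₗ[ℝ] ℝ`, through `mean_walkSum_loop_add_axial_eq_linAvg`); §3 `apply_iterLin` (naturality of the composites) and ★★ `norm_iterLin_le`.
HONEST FRAMING.  Bookkeeping, no definition; count-neutral helper toward R3 2′ (items 19936∕19935); (FL) NOT proved; registry
untouched; nothing about d = 4, the continuum, or a mass gap; YM₃ on T³ is rung R3, not Clay.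

References: T. Bałaban, Commun. Math. Phys. 98 (1985) 17–51 [Balaban1985Averaging] ((125) p.36, Prop. 4 (134)–(135) p.38); CMP 109 (1987) 249–301 [Balaban1987RG1] ((0.4), (0.11) p.253).
-/

set_option autoImplicit false

noncomputable section

namespace Summit.QuantumFields.YangMills.Theorems.LinearAvgMatrix

open Finset
open scoped Matrix.Norms.L2Operator
open Literature.MathematicalPhysics.QuantumFieldTheory.Balaban1983to89
open Literature.MathematicalPhysics.QuantumFieldTheory.Balaban1983to89.T4Continuum
open Literature.MathematicalPhysics.QuantumFieldTheory.Balaban1983to89.BlockAveraging (off Idx)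
open BlockAveragingEMLLinearised (walkSum walkSum_nil walkSum_cons linAvg)
open Summit.QuantumFields.YangMills.Theorems.AbelianEML (wsum wsum_nil wsum_cons_true wsum_cons_false loopSum axialSum linAvg04 linAvgIter)
open Summit.QuantumFields.YangMills.Theorems.EMLSecondOrder (mean_walkSum_loop_add_axial_eq_linAvg)
open Summit.QuantumFields.YangMills.Theorems.LinearAvgSup (abs_linAvgIter_le)

/-! ## §1 Matrix-norm utilities (`L²`-operator norm) -/

section Norms

variable {m : Type*} [Fintype m] [DecidableEq m]

/-- The real and imaginary parts of every entry are bounded by the `L²`-operator norm. [folklore] -/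
theorem abs_re_im_entry_le_norm (A : Matrix m m ℂ) (i j : m) : |(A i j).re| ≤ ‖A‖ ∧ |(A i j).im| ≤ ‖A‖ := by
  have hA : ‖A i j‖ ≤ ‖A‖ := by
    have h := Matrix.l2_opNorm_mulVec A (EuclideanSpace.single j (1 : ℂ))
    have h1 : ‖(EuclideanSpace.single j (1 : ℂ))‖ = 1 := by simp
    rw [h1, mul_one] at h
    refine le_trans ?_ h
    refine le_trans (le_of_eq ?_) (PiLp.norm_apply_le _ i)
    simp
  exact ⟨(Complex.abs_re_le_norm _).trans hA, (Complex.abs_im_le_norm _).trans hA⟩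

/-- **`‖A‖ ≤ Σ_{i,j} (|Re A_{ij}| + |Im A_{ij}|)`** for the `L²`-operator norm (`ℓ² ≤ ℓ¹` on the image, `‖z‖ ≤ |Re z| + |Im z|`). [folklore] -/
theorem norm_le_sum_abs_re_add_abs_im (A : Matrix m m ℂ) : ‖A‖ ≤ ∑ i, ∑ j, (|(A i j).re| + |(A i j).im|) := by
  -- `ℓ² ≤ ℓ¹` on a Euclidean space
  have hl1 : ∀ v : EuclideanSpace ℂ m, ‖v‖ ≤ ∑ i, ‖v i‖ := fun v => by
    have hv : v = ∑ i, EuclideanSpace.single i (v i) := by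
      ext k
      simp [Finset.sum_apply]
    calc ‖v‖ = ‖∑ i, EuclideanSpace.single i (v i)‖ := by rw [← hv]
      _ ≤ ∑ i, ‖EuclideanSpace.single i (v i)‖ := norm_sum_le _ _
      _ = ∑ i, ‖v i‖ := sum_congr rfl fun i _ => by simp
  have hop : ‖A‖ ≤ ∑ i, ∑ j, ‖A i j‖ := by
    rw [Matrix.l2_opNorm_def]
    refine ContinuousLinearMap.opNorm_le_bound _ (sum_nonneg fun i _ => sum_nonneg fun j _ => norm_nonneg _) fun v => ?_
    have hv : ∀ j, ‖(WithLp.ofLp v : m → ℂ) j‖ ≤ ‖v‖ := fun j => PiLp.norm_apply_le v j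
    calc ‖(Matrix.toEuclideanCLM (n := m) (𝕜 := ℂ) A) v‖
        = ‖(WithLp.toLp 2 (A.mulVec (WithLp.ofLp v)) : EuclideanSpace ℂ m)‖ := rfl
      _ ≤ ∑ i, ‖(WithLp.toLp 2 (A.mulVec (WithLp.ofLp v)) : EuclideanSpace ℂ m) i‖ := hl1 _
      _ = ∑ i, ‖∑ j, A i j * (WithLp.ofLp v) j‖ := rfl
      _ ≤ ∑ i, ∑ j, ‖A i j‖ * ‖v‖ := by
          refine sum_le_sum fun i _ => (norm_sum_le _ _).trans (sum_le_sum fun j _ => ?_)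
          rw [norm_mul]
          exact mul_le_mul_of_nonneg_left (hv j) (norm_nonneg _)
      _ = (∑ i, ∑ j, ‖A i j‖) * ‖v‖ := by rw [sum_mul]; exact sum_congr rfl fun i _ => (sum_mul _ _ _).symm
  exact hop.trans (sum_le_sum fun i _ => sum_le_sum fun j _ => Complex.norm_le_abs_re_add_abs_im _)

end Norms

/-! ## §2 Naturality of the signed walk sums and of the one-step (0.4)-linear average -/

section Walks

variable {P : Params} {j : ℕ} {V W : Type*} [AddCommGroup V] [AddCommGroup W]

/-- Additive maps pass through signed walk sums. [cite: Balaban1984PropagatorsI, (1.8) p.19 (bookkeeping)] -/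
theorem map_walkSum {F : Type*} [FunLike F V W] [AddMonoidHomClass F V W] (φ : F) (Y : PBond P j → V) :
    ∀ γ : List (LStep P j), φ (walkSum Y γ) = walkSum (fun b => φ (Y b)) γ
  | [] => by simp
  | s :: γ => by
    rw [walkSum_cons, walkSum_cons, map_add, map_walkSum φ Y γ]
    cases s.fwd <;> simp

/-- **ON REALS THE STEP-LIST SUM ALONG `walk x w` IS `AbelianEML.wsum`.** [cite: Balaban1985Averaging, (9) p.18 (bookkeeping)] -/
theorem walkSum_walk_eq_wsum (a : PBond P j → ℝ) : ∀ (w : List (Letter P.d)) (x : Site P j), walkSum a (walk x w) = wsum a x w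
  | [], x => by simp [walk]
  | (μ, true) :: w, x => by
    rw [wsum_cons_true, ← walkSum_walk_eq_wsum a w]
    simp [walk, walkSum_cons]
  | (μ, false) :: w, x => by
    rw [wsum_cons_false, ← walkSum_walk_eq_wsum a w]
    simp [walk, walkSum_cons]

end Walks

section Scalars

variable {n : Type*} {P : Params} {j : ℕ}

/-- A real multiple inside `Matrix n n ℂ`: `(r : ℂ) • M = r • M`. [folklore] -/
theorem coe_real_smul (r : ℝ) (M : Matrix n n ℂ) : ((r : ℂ)) • M = r • M := (RCLike.real_smul_eq_coe_smul (K := ℂ) r M).symm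

/-- The real part of the `(i,j)` entry is an `ℝ`-linear functional (`Complex.reLm ∘ Matrix.entryLinearMap`). [folklore] -/
theorem reLm_comp_entry_apply (i j : n) (M : Matrix n n ℂ) : (Complex.reLm.comp (Matrix.entryLinearMap ℝ ℂ i j)) M = (M i j).re := rfl

/-- The imaginary part of the `(i,j)` entry is an `ℝ`-linear functional (`Complex.imLm ∘ Matrix.entryLinearMap`). [folklore] -/
theorem imLm_comp_entry_apply (i j : n) (M : Matrix n n ℂ) : (Complex.imLm.comp (Matrix.entryLinearMap ℝ ℂ i j)) M = (M i j).im := rfl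

end Scalars

section Matrices

variable {n : Type*} [Fintype n] [DecidableEq n] [Nonempty n] {P : Params} {j : ℕ}

/-- **★ NATURALITY OF THE ONE-STEP (0.4)-LINEAR AVERAGE**: for an `ℝ`-linear functional `φ`, `φ((Q₁Y)(c)) = linAvg04 (φ ∘ Y) c` — the matrix-side loop form `mean_walkSum_loop_add_axial_eq_linAvg`
read through `φ`, `map_walkSum`, `walkSum_walk_eq_wsum`. [cite: Balaban1987RG1, (0.4) p.253; Balaban1985Averaging, (125) p.36] -/
theorem apply_linAvg (φ : Matrix n n ℂ →ₗ[ℝ] ℝ) (Y : PBond P j → Matrix n n ℂ) (c : PBond P (j + 1)) :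
    φ (linAvg Y c) = linAvg04 (fun b => φ (Y b)) c := by
  rw [← mean_walkSum_loop_add_axial_eq_linAvg Y c]
  have hcast : ((Fintype.card (Idx P) : ℂ))⁻¹ = (((Fintype.card (Idx P) : ℝ)⁻¹ : ℝ) : ℂ) := by push_cast; rfl
  rw [hcast, coe_real_smul, map_add, map_smul, map_sum]
  unfold linAvg04 loopSum axialSum
  rw [smul_eq_mul]
  congr 1
  · congr 1
    exact sum_congr rfl fun i _ => by rw [map_walkSum, walkSum_walk_eq_wsum]
  · rw [map_walkSum, walkSum_walk_eq_wsum]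

/-! ## §3 The composites of `linAvg`: naturality and the `s`-uniform sup bound -/

/-- **★ NATURALITY OF THE ITERATES**: for every family `Q` with `Q 0 Y = Y` and `Q (s+1) Y c = linAvg (Q s Y) c` (the `s`-fold composite of `linAvg` across the levels —
characterised, not defined, as in `Prop7AvgLinearisation.norm_iter_sub_one_sub_iterLin_le`) and every `ℝ`-linear functional `φ`: `φ (Q s Y c) = linAvgIter s (φ ∘ Y) c`.
[cite: Balaban1987RG1, (0.11) p.253] -/
theorem apply_iterLin (Q : (i : ℕ) → (PBond P 0 → Matrix n n ℂ) → PBond P i → Matrix n n ℂ)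
    (hQ0 : ∀ Y, Q 0 Y = Y) (hQs : ∀ (i : ℕ) (Y : PBond P 0 → Matrix n n ℂ) (c : PBond P (i + 1)), Q (i + 1) Y c = linAvg (Q i Y) c)
    (φ : Matrix n n ℂ →ₗ[ℝ] ℝ) (Y : PBond P 0 → Matrix n n ℂ) :
    ∀ (s : ℕ) (c : PBond P s), φ (Q s Y c) = linAvgIter s (fun b => φ (Y b)) c
  | 0, c => by rw [hQ0]; rfl
  | s + 1, c => by
    rw [hQs, apply_linAvg, AbelianEML.linAvgIter_succ]
    congr 1
    funext b
    exact apply_iterLin Q hQ0 hQs φ Y s b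

/-- **★★ THE `s`-UNIFORM SUP BOUND OF THE MATRIX ITERATES**: for every such family `Q`, if `‖Y_b‖ ≤ δ` for every finest bond then `‖(Q s Y)(c)‖ ≤ 2|n|²·(d+1)·L^s·δ` for every `s`
and every level-`s` bond — each real coordinate `Re∕Im (· i j)` of the iterate is the real iterate of the coordinate (naturality), bounded by `(d+1)L^s δ` (`abs_linAvgIter_le`), and
`‖M‖ ≤ Σ_{i,j}(|Re M_{ij}| + |Im M_{ij}|)`.  The constant does NOT depend on `s` (one-step bounds iterated would give `(3ℓ)^s`). [cite: Balaban1985Averaging, Prop. 4 (130)–(131) p.38; Balaban1987RG1, (0.11) p.253] -/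
theorem norm_iterLin_le (Q : (i : ℕ) → (PBond P 0 → Matrix n n ℂ) → PBond P i → Matrix n n ℂ)
    (hQ0 : ∀ Y, Q 0 Y = Y) (hQs : ∀ (i : ℕ) (Y : PBond P 0 → Matrix n n ℂ) (c : PBond P (i + 1)), Q (i + 1) Y c = linAvg (Q i Y) c)
    (Y : PBond P 0 → Matrix n n ℂ) {δ : ℝ} (hY : ∀ b, ‖Y b‖ ≤ δ) (s : ℕ) (c : PBond P s) :
    ‖Q s Y c‖ ≤ 2 * (Fintype.card n : ℝ) ^ 2 * (((P.d : ℝ) + 1) * (P.L : ℝ) ^ s * δ) := by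
  set M := Q s Y c with hM
  have hre : ∀ i j, |(M i j).re| ≤ ((P.d : ℝ) + 1) * (P.L : ℝ) ^ s * δ := fun i j => by
    have h := abs_linAvgIter_le (fun b => (Complex.reLm.comp (Matrix.entryLinearMap ℝ ℂ i j)) (Y b)) (M := δ) (fun b => ?_) s c
    · rwa [← apply_iterLin Q hQ0 hQs _ Y s c, reLm_comp_entry_apply] at h
    · rw [reLm_comp_entry_apply]
      exact (abs_re_im_entry_le_norm _ i j).1.trans (hY b)
  have him : ∀ i j, |(M i j).im| ≤ ((P.d : ℝ) + 1) * (P.L : ℝ) ^ s * δ := fun i j => by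
    have h := abs_linAvgIter_le (fun b => (Complex.imLm.comp (Matrix.entryLinearMap ℝ ℂ i j)) (Y b)) (M := δ) (fun b => ?_) s c
    · rwa [← apply_iterLin Q hQ0 hQs _ Y s c, imLm_comp_entry_apply] at h
    · rw [imLm_comp_entry_apply]
      exact (abs_re_im_entry_le_norm _ i j).2.trans (hY b)
  calc ‖M‖ ≤ ∑ i, ∑ j, (|(M i j).re| + |(M i j).im|) := norm_le_sum_abs_re_add_abs_im M
    _ ≤ ∑ _i : n, ∑ _j : n, 2 * (((P.d : ℝ) + 1) * (P.L : ℝ) ^ s * δ) :=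
        sum_le_sum fun i _ => sum_le_sum fun j _ => by linarith [hre i j, him i j]
    _ = 2 * (Fintype.card n : ℝ) ^ 2 * (((P.d : ℝ) + 1) * (P.L : ℝ) ^ s * δ) := by
        simp only [sum_const, card_univ, nsmul_eq_mul]; ring

end Matrices

end Summit.QuantumFields.YangMills.Theorems.LinearAvgMatrix

end
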